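import Literature.NumberTheory.Automorphic.LevelActionInducedRegular
import HarnessLib

/-!
# The auxiliary `Q`-modules of finite-level control

Topic `NumberTheory/Automorphic`; namespace `Literature.NumberTheory.Automorphic.LevelAction`;
definitions with bodies and theorems, no named fact, no instance, no `sorry`.  Universe `0`.

For a finite group `Q` and a commutative ring `R`, the regular representation `R[Q] = Fun(Q, R)`
(`piRegular`, from `LevelActionInducedRegular`) sits in the two short exact sequences of
`Q`-modules that control invariants and coinvariants:

* **degree-one (invariant) control**: `0 → R →η→ R[Q] → C → 0` with `C = R[Q]/R·𝟙`
  (`cokerUnitRep`), and `0 → C →m→ ⊕_{t ∈ Q} R[Q] → C'' → 0` (`diffMap`: `[φ] ↦ ((R_t − 1) φ)_t`,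
  injective because `R[Q]^Q = R · 𝟙`; `cokerDiffRep`), so that `t`-th projection `∘ m ∘ (R[Q] → C)`
  is `R_t − 1` (`proj_comp_diffMap_comp_mkQ`);
* **top-degree (coinvariant) control**: `0 → I_Q → R[Q] →ε→ R → 0` (`augKerRep`, `ε` surjective)
  and `0 → K → ⊕_{t ∈ Q} R[Q] →σ→ I_Q → 0` with `σ(ψ) = ∑_t (R_t − 1) ψ_t` SURJECTIVE onto the
  augmentation kernel (`sumDiff_surjective`: `φ = ∑_q φ(q) (R_{q⁻¹} − 1) 𝟙_{1}` when `∑ φ = 0`),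
  `σ ∘ incl_t = R_t − 1` (`subtype_comp_sumDiff_comp_single`).

Together with the diagonal representation on `⊕_t = Fun(T, -)` (`piDiag`) and its
projections / inclusions (`proj_equivariant`, `single_equivariant`, `sum_single_comp_proj`), this is
all the `Q`-module input of [cite: KhareThorne2017, §6.3, proof of Prop. 6.6] (where it appears as
the computation of `Tor` / `Ext` over `𝒪[Δ̄]` through the bar-type resolution by sums of copies
of the group ring).

## References

* C. Khare, J. A. Thorne, Amer. J. Math. 139 (2017), §6.3. [KhareThorne2017]
* K. S. Brown, *Cohomology of groups*, GTM 87, I.2 (augmentation ideal), III.1. [Brown1982CohomologyGroups]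
-/

noncomputable section

namespace Literature.NumberTheory.Automorphic

namespace LevelAction

/-! ### The diagonal representation on `Fun(T, N)` -/

section PiDiag

variable {R : Type} [CommRing R] {Q : Type} [Group Q] {N : Type} [AddCommGroup N] [Module R N]
  (ρ : Representation R Q N) (T : Type)

/-- **The diagonal representation on `Fun(T, N) = ⊕_{t ∈ T} N`** (`T` finite in the applications).
[folklore] -/
def piDiag : Representation R Q (T → N) where
  toFun q := (ρ q).compLeft T
  map_one' := LinearMap.ext fun Ψ => funext fun t => by
    simp only [LinearMap.compLeft_apply, Function.comp_apply, map_one, Module.End.one_apply]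
  map_mul' a b := LinearMap.ext fun Ψ => funext fun t => by
    simp only [LinearMap.compLeft_apply, Function.comp_apply, map_mul, Module.End.mul_apply]

/-- Unfolding `piDiag`. [folklore] -/
@[simp]
theorem piDiag_apply (q : Q) (Ψ : T → N) (t : T) : piDiag ρ T q Ψ t = ρ q (Ψ t) := rfl

/-- The projections are equivariant. [folklore] -/
theorem proj_equivariant (t : T) (q : Q) :
    (LinearMap.proj t : (T → N) →ₗ[R] N) ∘ₗ piDiag ρ T q = ρ q ∘ₗ LinearMap.proj t :=
  LinearMap.ext fun _ => rfl

/-- The inclusions are equivariant. [folklore] -/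
theorem single_equivariant [DecidableEq T] (t : T) (q : Q) :
    LinearMap.single R (fun _ : T => N) t ∘ₗ ρ q = piDiag ρ T q ∘ₗ LinearMap.single R (fun _ : T => N) t :=
  LinearMap.ext fun n => funext fun t' => by
    simp only [LinearMap.comp_apply, LinearMap.coe_single, piDiag_apply]
    exact (Pi.apply_single (fun _ => ρ q) (fun _ => map_zero _) t n t').symm

/-- `∑_t incl_t ∘ proj_t = id` on `Fun(T, N)`. [folklore] -/
theorem sum_single_comp_proj [Fintype T] [DecidableEq T] :
    ∑ t : T, LinearMap.single R (fun _ : T => N) t ∘ₗ LinearMap.proj t = LinearMap.id :=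
  LinearMap.ext fun Ψ => by
    simp only [LinearMap.coe_sum, Finset.sum_apply, LinearMap.comp_apply, LinearMap.coe_single,
      LinearMap.proj_apply, LinearMap.id_apply]
    exact Finset.univ_sum_single Ψ

end PiDiag

/-! ### The unit sequence `0 → R → R[Q] → C → 0` and `C ↪ ⊕_t R[Q]` -/

section Unit

variable (R : Type) [CommRing R] (Q : Type) [Group Q]

/-- `η` is injective. [folklore] -/
theorem unitMap_injective : Function.Injective (unitMap R Q) := fun r r' h => by
  have h1 := congr_fun h 1
  rwa [unitMap_apply, unitMap_apply] at h1

/-- `R · 𝟙 ⊆ R[Q]` is `Q`-stable. [folklore] -/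
theorem range_unitMap_le_comap (q : Q) :
    LinearMap.range (unitMap R Q) ≤ (LinearMap.range (unitMap R Q)).comap (piRegular R Q q) := by
  rintro _ ⟨r, rfl⟩
  refine ⟨r, ?_⟩
  have h := LinearMap.congr_fun (unitMap_equivariant R Q q) r
  simpa only [LinearMap.comp_apply, Representation.trivial_apply] using h

/-- **`C = R[Q] / R·𝟙`** with its `Q`-action. [cite: KhareThorne2017, §6.3] -/
def cokerUnitRep : Representation R Q ((Q → R) ⧸ LinearMap.range (unitMap R Q)) :=
  (piRegular R Q).quotient _ (range_unitMap_le_comap R Q)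

/-- The quotient map `R[Q] → C` is equivariant. [folklore] -/
theorem mkQ_unit_equivariant (q : Q) :
    (LinearMap.range (unitMap R Q)).mkQ ∘ₗ piRegular R Q q =
      cokerUnitRep R Q q ∘ₗ (LinearMap.range (unitMap R Q)).mkQ :=
  LinearMap.ext fun _ => rfl

omit [Group Q] in
/-- `0 → R → R[Q] → C → 0` is exact in the middle. [folklore] -/
theorem exact_unitMap_mkQ :
    Function.Exact (unitMap R Q) (LinearMap.range (unitMap R Q)).mkQ :=
  LinearMap.exact_map_mkQ_range _

/-- **`φ ↦ ((R_t − 1) φ)_t : R[Q] → ⊕_{t ∈ Q} R[Q]`.** [cite: KhareThorne2017, §6.3] -/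
def diffFun : (Q → R) →ₗ[R] (Q → Q → R) :=
  LinearMap.pi fun t => rightShift R Q t - LinearMap.id

/-- Unfolding `diffFun`. [folklore] -/
@[simp]
theorem diffFun_apply (φ : Q → R) (t q : Q) : diffFun R Q φ t q = φ (q * t) - φ q := rfl

/-- `t`-th component of `diffFun` is `R_t − 1`. [folklore] -/
theorem proj_comp_diffFun (t : Q) :
    (LinearMap.proj t : (Q → Q → R) →ₗ[R] Q → R) ∘ₗ diffFun R Q = rightShift R Q t - LinearMap.id :=
  LinearMap.ext fun _ => rfl

/-- `diffFun` is equivariant (regular action, diagonal regular action). [folklore] -/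
theorem diffFun_equivariant (q : Q) :
    diffFun R Q ∘ₗ piRegular R Q q = piDiag (piRegular R Q) Q q ∘ₗ diffFun R Q :=
  LinearMap.ext fun φ => funext fun t => funext fun q' => by
    simp only [LinearMap.comp_apply, diffFun_apply, piRegular_apply, piDiag_apply, mul_assoc]

/-- **`ker (φ ↦ ((R_t − 1)φ)_t) = R · 𝟙`**: the `Q`-invariants of the regular representation are the
constants. [cite: Brown1982CohomologyGroups, III.1] -/
theorem ker_diffFun : LinearMap.ker (diffFun R Q) = LinearMap.range (unitMap R Q) := by
  apply le_antisymm
  · intro φ hφ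
    refine ⟨φ 1, funext fun q => ?_⟩
    have h := congr_fun (congr_fun (LinearMap.mem_ker.1 hφ) q) 1
    rw [diffFun_apply, one_mul, Pi.zero_apply, Pi.zero_apply, sub_eq_zero] at h
    rw [unitMap_apply, h]
  · rintro _ ⟨r, rfl⟩
    rw [LinearMap.mem_ker]
    funext t q
    rw [diffFun_apply, unitMap_apply, unitMap_apply, sub_self]
    rfl

/-- **`m : C → ⊕_t R[Q]`, `[φ] ↦ ((R_t − 1)φ)_t`.** [cite: KhareThorne2017, §6.3] -/
def diffMap : ((Q → R) ⧸ LinearMap.range (unitMap R Q)) →ₗ[R] (Q → Q → R) :=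
  (LinearMap.range (unitMap R Q)).liftQ (diffFun R Q) (by rw [ker_diffFun])

/-- Unfolding `diffMap` on classes. [folklore] -/
@[simp]
theorem diffMap_mk (φ : Q → R) :
    diffMap R Q (Submodule.Quotient.mk φ) = diffFun R Q φ := rfl

/-- `diffMap ∘ (R[Q] → C) = diffFun`. [folklore] -/
theorem diffMap_comp_mkQ : diffMap R Q ∘ₗ (LinearMap.range (unitMap R Q)).mkQ = diffFun R Q :=
  LinearMap.ext fun _ => rfl

/-- **`m` is injective** (`R[Q]^Q = R·𝟙`). [cite: KhareThorne2017, §6.3] -/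
theorem diffMap_injective : Function.Injective (diffMap R Q) := by
  rw [← LinearMap.ker_eq_bot]
  exact Submodule.ker_liftQ_eq_bot _ _ _ (by rw [ker_diffFun])

/-- `m` is equivariant. [folklore] -/
theorem diffMap_equivariant (q : Q) :
    diffMap R Q ∘ₗ cokerUnitRep R Q q = piDiag (piRegular R Q) Q q ∘ₗ diffMap R Q :=
  Submodule.linearMap_qext _ (by
    rw [LinearMap.comp_assoc, ← mkQ_unit_equivariant, ← LinearMap.comp_assoc, diffMap_comp_mkQ,
      diffFun_equivariant, LinearMap.comp_assoc, diffMap_comp_mkQ])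

/-- `range m` is `Q`-stable. [folklore] -/
theorem range_diffMap_le_comap (q : Q) :
    LinearMap.range (diffMap R Q) ≤ (LinearMap.range (diffMap R Q)).comap (piDiag (piRegular R Q) Q q) := by
  rintro _ ⟨c, rfl⟩
  refine ⟨cokerUnitRep R Q q c, ?_⟩
  have h := LinearMap.congr_fun (diffMap_equivariant R Q q) c
  simpa only [LinearMap.comp_apply] using h

/-- **`C'' = (⊕_t R[Q]) / m(C)`** with its `Q`-action. [cite: KhareThorne2017, §6.3] -/
def cokerDiffRep : Representation R Q ((Q → Q → R) ⧸ LinearMap.range (diffMap R Q)) :=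
  (piDiag (piRegular R Q) Q).quotient _ (range_diffMap_le_comap R Q)

/-- The quotient map `⊕_t R[Q] → C''` is equivariant. [folklore] -/
theorem mkQ_diff_equivariant (q : Q) :
    (LinearMap.range (diffMap R Q)).mkQ ∘ₗ piDiag (piRegular R Q) Q q =
      cokerDiffRep R Q q ∘ₗ (LinearMap.range (diffMap R Q)).mkQ :=
  LinearMap.ext fun _ => rfl

/-- `0 → C → ⊕_t R[Q] → C'' → 0` is exact in the middle. [folklore] -/
theorem exact_diffMap_mkQ :
    Function.Exact (diffMap R Q) (LinearMap.range (diffMap R Q)).mkQ :=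
  LinearMap.exact_map_mkQ_range _

/-- **`proj_t ∘ m ∘ (R[Q] → C) = R_t − 1`.** [cite: KhareThorne2017, §6.3] -/
theorem proj_comp_diffMap_comp_mkQ (t : Q) :
    (LinearMap.proj t : (Q → Q → R) →ₗ[R] Q → R) ∘ₗ diffMap R Q ∘ₗ (LinearMap.range (unitMap R Q)).mkQ =
      rightShift R Q t - LinearMap.id :=
  LinearMap.ext fun _ => rfl

/-- `R_t − 1` is equivariant. [folklore] -/
theorem rightShift_sub_id_equivariant (t q : Q) :
    (rightShift R Q t - LinearMap.id) ∘ₗ piRegular R Q q = piRegular R Q q ∘ₗ (rightShift R Q t - LinearMap.id) := by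
  rw [LinearMap.sub_comp, LinearMap.comp_sub, rightShift_equivariant, LinearMap.id_comp, LinearMap.comp_id]

end Unit

/-! ### The augmentation sequence `0 → I_Q → R[Q] → R → 0` and `⊕_t R[Q] ↠ I_Q` -/

section Aug

variable (R : Type) [CommRing R] (Q : Type) [Group Q] [Fintype Q]

/-- `ε` is surjective. [folklore] -/
theorem augMap_surjective [DecidableEq Q] : Function.Surjective (augMap R Q) := fun r =>
  ⟨Pi.single 1 r, by rw [augMap_apply]; exact Fintype.sum_pi_single' 1 r⟩

/-- `I_Q = ker ε` is `Q`-stable. [folklore] -/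
theorem ker_augMap_le_comap (q : Q) :
    LinearMap.ker (augMap R Q) ≤ (LinearMap.ker (augMap R Q)).comap (piRegular R Q q) := fun φ hφ => by
  rw [Submodule.mem_comap, LinearMap.mem_ker, ← LinearMap.comp_apply, augMap_equivariant,
    LinearMap.comp_apply, LinearMap.mem_ker.1 hφ, map_zero]

/-- **The augmentation kernel `I_Q ⊆ R[Q]`** with its `Q`-action. [cite: Brown1982CohomologyGroups, I.2] -/
def augKerRep : Representation R Q (LinearMap.ker (augMap R Q)) :=
  (piRegular R Q).subrepresentation _ (ker_augMap_le_comap R Q)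

/-- The inclusion `I_Q ↪ R[Q]` is equivariant. [folklore] -/
theorem subtype_aug_equivariant (q : Q) :
    (LinearMap.ker (augMap R Q)).subtype ∘ₗ augKerRep R Q q = piRegular R Q q ∘ₗ (LinearMap.ker (augMap R Q)).subtype :=
  LinearMap.ext fun _ => rfl

omit [Group Q] in
/-- `0 → I_Q → R[Q] → R → 0` is exact in the middle. [folklore] -/
theorem exact_subtype_augMap : Function.Exact (LinearMap.ker (augMap R Q)).subtype (augMap R Q) :=
  LinearMap.exact_subtype_ker_map _

/-- `ε ∘ (R_t − 1) = 0`. [folklore] -/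
theorem augMap_comp_rightShift_sub_id (t : Q) : augMap R Q ∘ₗ (rightShift R Q t - LinearMap.id) = 0 :=
  LinearMap.ext fun φ => by
    simp only [LinearMap.comp_apply, LinearMap.sub_apply, LinearMap.id_apply, map_sub, augMap_apply,
      rightShift_apply, LinearMap.zero_apply, sub_eq_zero]
    exact Fintype.sum_equiv (Equiv.mulRight t) _ _ fun _ => rfl

/-- **`σ₀ : ⊕_t R[Q] → R[Q]`, `ψ ↦ ∑_t (R_t − 1) ψ_t`.** [cite: Brown1982CohomologyGroups, I.2] -/
def sumDiffFun : (Q → Q → R) →ₗ[R] (Q → R) :=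
  ∑ t : Q, (rightShift R Q t - LinearMap.id) ∘ₗ LinearMap.proj t

/-- Unfolding `sumDiffFun`. [folklore] -/
theorem sumDiffFun_apply (ψ : Q → Q → R) :
    sumDiffFun R Q ψ = ∑ t, (rightShift R Q t - LinearMap.id : (Q → R) →ₗ[R] Q → R) (ψ t) := by
  simp only [sumDiffFun, LinearMap.coe_sum, Finset.sum_apply, LinearMap.comp_apply, LinearMap.proj_apply]

/-- `σ₀` lands in `I_Q`. [folklore] -/
theorem sumDiffFun_mem (ψ : Q → Q → R) : sumDiffFun R Q ψ ∈ LinearMap.ker (augMap R Q) := by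
  rw [LinearMap.mem_ker, sumDiffFun_apply, map_sum]
  refine Finset.sum_eq_zero fun t _ => ?_
  rw [← LinearMap.comp_apply, augMap_comp_rightShift_sub_id, LinearMap.zero_apply]

/-- **`σ : ⊕_t R[Q] → I_Q`.** [cite: Brown1982CohomologyGroups, I.2] -/
def sumDiff : (Q → Q → R) →ₗ[R] LinearMap.ker (augMap R Q) :=
  LinearMap.codRestrict _ (sumDiffFun R Q) (sumDiffFun_mem R Q)

/-- Unfolding `sumDiff`. [folklore] -/
@[simp]
theorem coe_sumDiff_apply (ψ : Q → Q → R) : (sumDiff R Q ψ : Q → R) = sumDiffFun R Q ψ := rfl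

/-- `σ₀ ∘ incl_t = R_t − 1`. [folklore] -/
theorem sumDiffFun_single [DecidableEq Q] (t : Q) (φ : Q → R) :
    sumDiffFun R Q (Pi.single t φ) = (rightShift R Q t - LinearMap.id : (Q → R) →ₗ[R] Q → R) φ := by
  rw [sumDiffFun_apply, Fintype.sum_eq_single t fun t' ht' => by rw [Pi.single_eq_of_ne ht', map_zero],
    Pi.single_eq_same]

/-- **`incl ∘ σ ∘ incl_t = R_t − 1`** (the `e_t` of the top-degree control). [folklore] -/
theorem subtype_comp_sumDiff_comp_single [DecidableEq Q] (t : Q) :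
    (LinearMap.ker (augMap R Q)).subtype ∘ₗ sumDiff R Q ∘ₗ LinearMap.single R (fun _ : Q => Q → R) t =
      rightShift R Q t - LinearMap.id :=
  LinearMap.ext fun φ => by
    rw [LinearMap.comp_apply, LinearMap.comp_apply, Submodule.subtype_apply, coe_sumDiff_apply,
      LinearMap.coe_single]
    exact sumDiffFun_single R Q t φ

/-- **`σ` is surjective onto `I_Q`**: `φ = ∑_t (R_t − 1)(φ(t⁻¹) 𝟙_{1})` when `∑ φ = 0`
(`I_Q = ∑_t R[Q](t − 1)`). [cite: Brown1982CohomologyGroups, I.2] -/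
theorem sumDiff_surjective [DecidableEq Q] : Function.Surjective (sumDiff R Q) := by
  rintro ⟨φ, hφ⟩
  rw [LinearMap.mem_ker, augMap_apply] at hφ
  refine ⟨fun t => φ t⁻¹ • Pi.single (1 : Q) (1 : R), Subtype.ext (funext fun x => ?_)⟩
  rw [coe_sumDiff_apply, sumDiffFun_apply, Finset.sum_apply]
  simp only [LinearMap.sub_apply, rightShift_apply, LinearMap.id_apply, Pi.smul_apply,
    Pi.sub_apply, smul_eq_mul, Finset.sum_sub_distrib]
  have h1 : ∑ t : Q, φ t⁻¹ * (Pi.single (1 : Q) (1 : R) : Q → R) (x * t) = φ x := by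
    rw [Fintype.sum_eq_single x⁻¹ fun t ht => ?_]
    · rw [inv_inv, mul_inv_cancel, Pi.single_eq_same, mul_one]
    · rw [Pi.single_eq_of_ne (fun h => ht (eq_inv_of_mul_eq_one_right h)), mul_zero]
  have h2 : ∑ t : Q, φ t⁻¹ * (Pi.single (1 : Q) (1 : R) : Q → R) x = 0 := by
    rw [← Finset.sum_mul, Fintype.sum_equiv (Equiv.inv Q) (fun t => φ t⁻¹) φ fun _ => rfl, hφ, zero_mul]
  rw [h1, h2, sub_zero]

/-- `σ` is equivariant (diagonal regular action on `⊕_t R[Q]`, restricted regular action on `I_Q`).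
[folklore] -/
theorem sumDiff_equivariant (q : Q) :
    sumDiff R Q ∘ₗ piDiag (piRegular R Q) Q q = augKerRep R Q q ∘ₗ sumDiff R Q :=
  LinearMap.ext fun ψ => Subtype.ext (by
    change sumDiffFun R Q (piDiag (piRegular R Q) Q q ψ) = piRegular R Q q (sumDiffFun R Q ψ)
    rw [sumDiffFun_apply, sumDiffFun_apply, map_sum]
    refine Finset.sum_congr rfl fun t _ => ?_
    rw [piDiag_apply, ← LinearMap.comp_apply, rightShift_sub_id_equivariant, LinearMap.comp_apply])

/-- `K = ker σ` is `Q`-stable. [folklore] -/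
theorem ker_sumDiff_le_comap (q : Q) :
    LinearMap.ker (sumDiff R Q) ≤ (LinearMap.ker (sumDiff R Q)).comap (piDiag (piRegular R Q) Q q) :=
  fun ψ hψ => by
    rw [Submodule.mem_comap, LinearMap.mem_ker, ← LinearMap.comp_apply, sumDiff_equivariant,
      LinearMap.comp_apply, LinearMap.mem_ker.1 hψ, map_zero]

/-- **`K = ker σ ⊆ ⊕_t R[Q]`** with its `Q`-action. [cite: KhareThorne2017, §6.3] -/
def sumDiffKerRep : Representation R Q (LinearMap.ker (sumDiff R Q)) :=
  (piDiag (piRegular R Q) Q).subrepresentation _ (ker_sumDiff_le_comap R Q)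

/-- The inclusion `K ↪ ⊕_t R[Q]` is equivariant. [folklore] -/
theorem subtype_sumDiffKer_equivariant (q : Q) :
    (LinearMap.ker (sumDiff R Q)).subtype ∘ₗ sumDiffKerRep R Q q =
      piDiag (piRegular R Q) Q q ∘ₗ (LinearMap.ker (sumDiff R Q)).subtype :=
  LinearMap.ext fun _ => rfl

/-- `0 → K → ⊕_t R[Q] → I_Q → 0` is exact in the middle. [folklore] -/
theorem exact_subtype_sumDiff : Function.Exact (LinearMap.ker (sumDiff R Q)).subtype (sumDiff R Q) :=
  LinearMap.exact_subtype_ker_map _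

end Aug

end LevelAction

end Literature.NumberTheory.Automorphic
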